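import Summits.ResolutionOfSingularities.ResolutionOfSingularities.Theorems.PurelyInseparableDim4ResConeDInfFrames
import Summits.ResolutionOfSingularities.ResolutionOfSingularities.Theorems.PurelyInseparableDim4PhiLineSupercritical
import Summits.ResolutionOfSingularities.ResolutionOfSingularities.Theorems.PurelyInseparableDim4ResConeBInfKeepStep
import HarnessLib
import HarnessLib.Audit.Tags

/-!
# (5,4) D∞ heavy line, STUB K₄: the KEEP-H step at a `(2)`-state — the carried label passes to the child with the same heavy
# letter and `βs` STRICTLY smaller (cell `res-dim4-pi`, K2(p) lane, slice C (5,4) TAIL-D; CARD I-1-9 «THE HEAVY LINE»)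

[OURS · counted 0 · cell `res-dim4-pi` · K2(p) lane (holder res-dim4-p-12 g4; desk WORD #180 default «p-7 g5 → K₄»); the
`μ = 4` twin of this lineage's STUB K `ResCone.stub_keep` (`…ResConeBInfKeepStep` p704534) for CARD I-1-9 of res-dim4-idea-1 g8
(re-presentation-free discharge of hN4-D); kernel hand res-dim4-p-7 g5.]  Nothing here proves TAIL-D, K2(5), `NoIsolatedTrap 5 5`
or resolution of singularities in dimension ≥ 4 / characteristic `p` — NOT proved.  AI kernel work, weaker than expert review.

At a `(2)`-state `c k` (`|r_k| = 2`, heavy letter `h` with `r_k h = 2 = p − d + 1`) of a D∞ tail with shade `4` and `e_G = 2`,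
carrying a run frame `L` (left inverse `M`, `u₁ = e_h`, y-rows in `(resVertex)^⊥`, label polygon `pts ≠ ∅`, `4! < δs`,
`2·αs ≤ 4!`, `0 < αs` for `(G_k)` at level `4`), the child `c (k+1)` carries a run frame `L′` with the same readings and
**`βs′ < βs`** (in fact `βs′ + 12 ≤ βs`: the heavy KEEP drop `1 − α ≥ 1/2`).  Composition = STUB K's, at `d = 4`:
1. `ResCone.dInf_two_state` (W₄ `dInf_pattern`: chart `m = j k ≠ h`, `b k h = 0`, `r_{k+1} h = 2`; and `r_k = 2e_h`, `o_k = 6`)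
   and `dInf_factorisation` / `dInf_step_factorisation` (`…ResConeDInfFrames`);
2. `ResCone.direction_mem_resVertex_of_shade_eq` (`o = 6 < 10`) and R2 `PhiLine.exists_keep_rechoice` (`μ = 4`);
3. XIV `PhiLine.exists_label_of_yRows_annihilate` (`d = 4 < 5`), VII `chartTransform_translate_label`, II
   `step_F_eq_monomial_mul_residual`; at a `(2)`-state the lost-boundary unit is `ε = 1` and the cleaning correction lies in
   `(x_h^3) ∩ (x_m^4)` (`dInf_two_state_newborn`);
4. res-dim4-p-11 g5's (K-Φ2) XV **`PhiLine.betaS_step_lt_of_keep_pow`** (`…PhiLineSupercritical`: IV with `r_h + n = p`, here `n = 3`,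
   cleaning transfer from the CHILD side) in the arrival frame (res-dim4-p-9's `arrival_left_inverse`), its child-side inputs
   `pts′ ≠ ∅`, `4·(αs′ + 1) ≤ 3·4!` supplied by the heavy (K-Φ1) `PhiLine.mul_alphaS_le_of_isIsolated` (`4·αs′ ≤ 2·4!`) at the
   isolated CHILD read in the arrival frame (`u₁ = x_h`, `r_{k+1} h = 2`): `pts′ ≠ ∅`, `αs′ = αs`, **`βs′ < βs`**;
5. X `PhiLine.exists_label_readaptation_of_step` read with `ε := 1`, `R := 0` (at a `(2)`-state the lost-boundary unit IS `1` and the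
   cleaning correction `R̃ ∈ (x_m^4)` folds into `x_m·Q′`), XI, XIII.
[cite: CossartJannsenSaito2020, Lemma 12.2 (5), Lemma 13.4 (3), Lemma 11.5, Thm. 8.16] [cite: CossartPiltant2008, (16), Prop. 4.2]
bears_on: LADDER-RESOLUTION:D157-DOOR2 (res-dim4-pi · K2(p) · slice C (5,4) TAIL-D · heavy line STUB K₄).  Supports
stmt-ResolutionOfSingularities-16155 (helper).
-/

set_option linter.dupNamespace false

noncomputable section

namespace Summit.ResolutionOfSingularities.ResolutionOfSingularities.Theorems.PIDim4


/-! ## STUB K₄: the KEEP-H step of the carried label at a `(2)`-state of a D∞ tail -/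

namespace ResCone

open MvPolynomial Finset IsLocalRing
open Literature.AlgebraicGeometry.Resolution
open Literature.AlgebraicGeometry.Resolution.CentreBlowup
open Literature.AlgebraicGeometry.Resolution.Hauser2010
open Literature.AlgebraicGeometry.Resolution.HauserPerlega2019
open Literature.AlgebraicGeometry.Resolution.WeightedOrder
open PointBlowup (additiveSubspace direction)

variable {K : Type} [Field K] [CharP K 5] [DecidableEq K]

/-- **STUB K₄ of the (5,4) D∞ heavy line (KEEP-H step of the carried label at a `(2)`-state)** — the `μ = 4` twin of
`ResCone.stub_keep`: run frame at `c k` (`|r_k| = 2`, `r_k h = 2`) ⟹ run frame at `c (k+1)` with the same heavy letter and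
`βs′ < βs`.  See the module docstring for the composition.
[cite: CossartJannsenSaito2020, Lemma 12.2 (5), Lemma 13.4 (3), Lemma 11.5] [cite: CossartPiltant2008, (16), Prop. 4.2] -/
theorem dInf_stub_keep {c : ℕ → State K} {j : ℕ → Fin 4} {b : ℕ → Fin 4 → K}
    (hc : ∀ k, IsIsolated 5 (c k).F ∧ Step0 5 (c k) (c (k + 1))) (hw : FreeTail.IsWitnessedChain 5 c j b)
    (hr0 : ∀ e ∈ (c 0).F.support, (c 0).r ≤ e) (hfloor : ∀ k, ordZero (c k).F ≠ 5) {k₀ : ℕ}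
    (hshade : ∀ k, k₀ ≤ k → (c k).shade = ((4 : ℕ) : ℕ∞))
    (he : ∀ k, k₀ ≤ k → Module.finrank K (resVertex (c k)) = 2)
    {k : ℕ} (hk : k₀ ≤ k) (h2 : (c k).r.degree = 2) {h : Fin 4} {L : Fin (2 + 2) → Fin 4 → K}
    {M : Fin 4 → Fin (2 + 2) → K}
    (hinv : ((∀ t u, ∑ i, M t i * L i u = if t = u then 1 else 0) ∧ L (u1 2) = Pi.single h 1 ∧
        (∀ i, i ≠ u1 2 → i ≠ u2 2 → ∀ w ∈ resVertex (c k), ∑ t, L i t * w t = 0) ∧ (c k).r h = 2 ∧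
        (pts (fun i => algebraMap (MvPolynomial (Fin 4) K) (OriginLocalization K 4) (∑ t, C (L i t) * X t))
          (Ideal.span {algebraMap (MvPolynomial (Fin 4) K) (OriginLocalization K 4)
            ((c k).F.divMonomial (c k).r)}) 4).Nonempty ∧
        Nat.factorial 4 < deltaS (fun i => algebraMap (MvPolynomial (Fin 4) K) (OriginLocalization K 4)
          (∑ t, C (L i t) * X t)) (Ideal.span {algebraMap (MvPolynomial (Fin 4) K) (OriginLocalization K 4)
            ((c k).F.divMonomial (c k).r)}) 4 ∧
        2 * alphaS (fun i => algebraMap (MvPolynomial (Fin 4) K) (OriginLocalization K 4) (∑ t, C (L i t) * X t))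
          (Ideal.span {algebraMap (MvPolynomial (Fin 4) K) (OriginLocalization K 4)
            ((c k).F.divMonomial (c k).r)}) 4 ≤ Nat.factorial 4) ∧
      0 < alphaS (fun i => algebraMap (MvPolynomial (Fin 4) K) (OriginLocalization K 4) (∑ t, C (L i t) * X t))
          (Ideal.span {algebraMap (MvPolynomial (Fin 4) K) (OriginLocalization K 4)
            ((c k).F.divMonomial (c k).r)}) 4) :
    ∃ (L' : Fin (2 + 2) → Fin 4 → K) (M' : Fin 4 → Fin (2 + 2) → K),
      (((∀ t u, ∑ i, M' t i * L' i u = if t = u then 1 else 0) ∧ L' (u1 2) = Pi.single h 1 ∧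
          (∀ i, i ≠ u1 2 → i ≠ u2 2 → ∀ w ∈ resVertex (c (k + 1)), ∑ t, L' i t * w t = 0) ∧ (c (k + 1)).r h = 2 ∧
          (pts (fun i => algebraMap (MvPolynomial (Fin 4) K) (OriginLocalization K 4) (∑ t, C (L' i t) * X t))
            (Ideal.span {algebraMap (MvPolynomial (Fin 4) K) (OriginLocalization K 4)
              ((c (k + 1)).F.divMonomial (c (k + 1)).r)}) 4).Nonempty ∧
          Nat.factorial 4 < deltaS (fun i => algebraMap (MvPolynomial (Fin 4) K) (OriginLocalization K 4)
            (∑ t, C (L' i t) * X t)) (Ideal.span {algebraMap (MvPolynomial (Fin 4) K) (OriginLocalization K 4)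
              ((c (k + 1)).F.divMonomial (c (k + 1)).r)}) 4 ∧
          2 * alphaS (fun i => algebraMap (MvPolynomial (Fin 4) K) (OriginLocalization K 4) (∑ t, C (L' i t) * X t))
            (Ideal.span {algebraMap (MvPolynomial (Fin 4) K) (OriginLocalization K 4)
              ((c (k + 1)).F.divMonomial (c (k + 1)).r)}) 4 ≤ Nat.factorial 4) ∧
        0 < alphaS (fun i => algebraMap (MvPolynomial (Fin 4) K) (OriginLocalization K 4) (∑ t, C (L' i t) * X t))
            (Ideal.span {algebraMap (MvPolynomial (Fin 4) K) (OriginLocalization K 4)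
              ((c (k + 1)).F.divMonomial (c (k + 1)).r)}) 4) ∧
      betaS (fun i => algebraMap (MvPolynomial (Fin 4) K) (OriginLocalization K 4) (∑ t, C (L' i t) * X t))
          (Ideal.span {algebraMap (MvPolynomial (Fin 4) K) (OriginLocalization K 4)
            ((c (k + 1)).F.divMonomial (c (k + 1)).r)}) 4 <
        betaS (fun i => algebraMap (MvPolynomial (Fin 4) K) (OriginLocalization K 4) (∑ t, C (L i t) * X t))
          (Ideal.span {algebraMap (MvPolynomial (Fin 4) K) (OriginLocalization K 4)
            ((c k).F.divMonomial (c k).r)}) 4 := by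
  haveI : Fact (Nat.Prime 5) := ⟨by norm_num⟩
  obtain ⟨⟨hM, hLu1, hy, hrh, hne, hδ, hα12⟩, hα0⟩ := hinv
  have h24 : Nat.factorial 4 = 24 := by decide
  have hα1 : alphaS (fun i => algebraMap (MvPolynomial (Fin 4) K) (OriginLocalization K 4) (∑ t, C (L i t) * X t))
      (Ideal.span {algebraMap (MvPolynomial (Fin 4) K) (OriginLocalization K 4) ((c k).F.divMonomial (c k).r)}) 4 <
        Nat.factorial 4 := by rw [h24] at hα12 ⊢; omega
  -- abbreviations
  set alg := algebraMap (MvPolynomial (Fin 4) K) (OriginLocalization K 4) with halg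
  set G := (c k).F.divMonomial (c k).r with hGdef
  set G' := (c (k + 1)).F.divMonomial (c (k + 1)).r with hG'def
  -- 1. the D∞ tail facts at `k` and `k + 1`
  obtain ⟨hF, hd, hp, hsupp⟩ := dInf_factorisation hc hw hr0 hfloor hshade hk
  have hk1 : k₀ ≤ k + 1 := hk.trans (Nat.le_succ k)
  obtain ⟨hF₁, hd₁, -, -⟩ := dInf_factorisation hc hw hr0 hfloor hshade hk1
  obtain ⟨hzero, ho, hjh, hbh, hr₁h, -⟩ := dInf_two_state hc hw hr0 hfloor hshade hk h2 hrh
  obtain ⟨hF', hd'⟩ := dInf_step_factorisation hc hw hr0 hfloor hshade hk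
  have hbm : b k (j k) = 0 := (hw k).2.1
  have hck1 : c (k + 1) = CentreBlowup.step 5 Finset.univ (j k) (b k) (c k) := (hw k).2.2.2.2
  have hhm : h ≠ j k := fun h' => hjh h'.symm
  have hdG : ((4 : ℕ) : ℕ∞) ≤ ordZero G := hd.symm.le
  have hJμ : Ideal.span {alg G} ≤ maximalIdeal (OriginLocalization K 4) ^ 4 :=
    PhiLine.span_singleton_algebraMap_le_maximalIdeal_pow hdG
  -- 2. the step direction lies in `resVertex (c k)`, so the y-rows kill it
  have hshade_eq : (CentreBlowup.step 5 Finset.univ (j k) (b k) (c k)).shade = (c k).shade := by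
    rw [← hck1, hshade (k + 1) hk1, hshade k hk]
  have hdir : direction (j k) (b k) ∈ resVertex (c k) :=
    direction_mem_resVertex_of_shade_eq (q := 5) (j k) hbm ho hsupp (by norm_num) (by norm_num) hshade_eq
  have hrows : ∀ i, i ≠ u1 2 → i ≠ u2 2 → ∑ t, L i t * Function.update (b k) (j k) 1 t = 0 :=
    fun i hi1 hi2 => hy i hi1 hi2 _ hdir
  -- R2: re-choose `u₂ := x_{j k}`
  obtain ⟨Lr, Mr, hMr, hLru1, hLru2, hLri, hnear, hner, hαr, hβr, hδr⟩ :=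
    PhiLine.exists_keep_rechoice L M hM hLu1 (dir := Function.update (b k) (j k) 1) (Function.update_self _ _ _)
      (by rw [Function.update_of_ne hhm, hbh]) hrows hJμ hne hα0
  -- the y-rows of the re-chosen frame still lie in `(resVertex (c k))^⊥`
  have hyr : ∀ i, i ≠ u1 2 → i ≠ u2 2 → ∀ w ∈ resVertex (c k), ∑ t, Lr i t * w t = 0 := by
    intro i hi1 hi2 w hw'
    rw [hLri i hi2]
    exact hy i hi1 hi2 w hw'
  obtain ⟨hArBr, hBrAr⟩ := matrix_inverses_of_leftInverse hMr
  -- 3. the departure label `G = Ψ(y) + Q` (XIV at `d = 4`)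
  obtain ⟨Ψ, hΨ, hΨA, Q, hQ, hGΨ⟩ := PhiLine.exists_label_of_yRows_annihilate 5 (d := 4) (by norm_num) hF hd hArBr hBrAr
    (he k hk) (fun i hi1 hi2 w hw' => by simpa only [Matrix.of_apply] using hyr i hi1 hi2 w hw')
  -- the weak transform read in the arrival y-rows (VII)
  obtain ⟨Q', hH₀⟩ := PhiLine.chartTransform_translate_label (j := j k) hbm (fun i : Fin 2 => Lr (Fin.castAdd 2 i))
    (fun i => hnear _ (castAdd_ne_u2 i)) hΨ hQ (G := G) (by simpa only [Matrix.of_apply] using hGΨ) hdG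
  -- the child residual `G' = ε · H₀ + R` (II + the step factorisation); at a `(2)`-state `ε = 1`
  obtain ⟨R, hstep, hRmem⟩ := PhiLine.step_F_eq_monomial_mul_residual (p := 5) (d := 4) hF hdG hp (j k) hbm
  rw [hF', monomial_one_mul_cancel_left_iff] at hstep
  obtain ⟨hr'm, -, hndm, -⟩ := dInf_two_state_newborn (K := K) h2 hhm (b := b k) hbh hrh
  have hRm : R ∈ Ideal.span {(X (j k) : MvPolynomial (Fin 4) K) ^ 4} := by
    have := hRmem (j k) hndm
    rwa [hr'm] at this
  have hεone : (∏ i ∈ Finset.univ.filter (fun i => b k i ≠ 0), (X i + C (b k i)) ^ (c k).r i : MvPolynomial (Fin 4) K) = 1 := by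
    refine Finset.prod_eq_one fun i hi => ?_
    rw [Finset.mem_filter] at hi
    have hih : i ≠ h := fun hih => hi.2 (hih ▸ hbh)
    rw [hzero i hih, pow_zero]
  rw [hεone, one_mul] at hstep
  -- 4. the arrival frame; the heavy (K-Φ1) at the isolated CHILD read in it; res-dim4-p-11 g5's child-side KEEP law
  set La : Fin (2 + 2) → Fin 4 → K :=
    Function.update (fun i => Function.update (Lr i) (j k) 0) (u2 2) (Pi.single (j k) 1) with hLa
  have hLau2 : La (u2 2) = Pi.single (j k) 1 := by rw [hLa, Function.update_self]
  have hLai : ∀ i, i ≠ u2 2 → La i = Function.update (Lr i) (j k) 0 := fun i hi => by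
    rw [hLa, Function.update_of_ne hi]
  have hLau1 : La (u1 2) = Pi.single h 1 := by
    rw [hLai _ u1_ne_u2, hLru1, PhiLine.update_single_of_ne hhm]
  have hMa := arrival_left_inverse hMr (piv := u2 2) hLru2 hLau2 hLai
  have hchild := PhiLine.mul_alphaS_le_of_isIsolated (p := 5) (d := 4) (n := 3) hF₁ (hc (k + 1)).1 (h := h) (by rw [hr₁h])
    (by norm_num) (fun i => alg (∑ t, C (La i t) * X t)) (span_range_frame_eq_maximalIdeal La _ hMa)
    (by simp only [hLau1, PhiLine.sum_C_single_mul_X]; rfl)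
  have hα' : 4 * (alphaS (fun i => alg (∑ t, C (La i t) * X t)) (Ideal.span {alg G'}) 4 + 1) ≤ 3 * Nat.factorial 4 := by
    have hb : 4 * alphaS (fun i => alg (∑ t, C (La i t) * X t)) (Ideal.span {alg G'}) 4 ≤ (3 - 1) * Nat.factorial 4 := hchild.2
    rw [h24] at hb ⊢; omega
  obtain ⟨hnea, hαa, hβa⟩ := PhiLine.betaS_step_lt_of_keep_pow (p := 5) (d := 4) (n := 3) hF hd (by norm_num) hp hhm
    (by rw [hrh]) (by norm_num) (by norm_num) hbm hbh Lr La Mr _ hMr hMa hLru1 hLru2 hnear hLau2 hLai hner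
    (by rw [hδr]; exact hδ) (by rw [hαr]; exact hα1) hF' hd' hchild.1 hα'
  -- 5. the arrival frame is again a label after re-adapting its y-rows along `u₁` (X with `ε := 1`, `R := 0`) …
  obtain ⟨hAB, hBA⟩ := matrix_inverses_of_leftInverse hMa
  have hT := PhiLine.two_le_finrank_additiveSubspace_of_resVertex hF₁ hd₁ (he (k + 1) hk1)
  have hrowsA : (fun i : Fin 2 => ∑ t, C ((Matrix.of fun (i : Fin 4) (t : Fin 4) => La i t) (Fin.castAdd 2 i) t) * X t) =
      fun i : Fin 2 => ∑ t, C (Function.update (Lr (Fin.castAdd 2 i)) (j k) 0 t) * X t := by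
    funext i
    simp only [Matrix.of_apply, hLai _ (castAdd_ne_u2 i)]
  obtain ⟨S, hS⟩ := Ideal.mem_span_singleton'.mp hRm
  have hG'A : G' = aeval (fun i : Fin 2 => ∑ t, C ((Matrix.of fun (i : Fin 4) (t : Fin 4) => La i t) (Fin.castAdd 2 i) t) * X t) Ψ +
      X (j k) * (Q' + X (j k) ^ 3 * S) := by
    rw [hrowsA, hG'def, hstep, hH₀, ← hS]; ring
  have hAu2 : (Matrix.of fun (i : Fin 4) (t : Fin 4) => La i t) (u2 2) = Pi.single (j k) 1 := by
    funext t; rw [Matrix.of_apply, hLau2]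
  have hAu1 : (Matrix.of fun (i : Fin 4) (t : Fin 4) => La i t) (u1 2) = Pi.single h 1 := by
    funext t; rw [Matrix.of_apply, hLau1]
  obtain ⟨lam, A', B', hA'B', hB'A', -, hA'u1, -, hne'', hδ'', hα'', hβ''⟩ :=
    PhiLine.exists_label_readaptation_of_step 5 (d := 4) (by norm_num) hAB hBA (u := u2 2)
      (Finset.mem_insert_of_mem (Finset.mem_singleton_self _)) hAu2 hAu1 (ε := 1) (R := 0) (e := 4) (by norm_num) le_rfl
      (by rw [one_mul, add_zero]; exact hG'A) hd' (by rw [map_one]; exact one_ne_zero) (Ideal.zero_mem _)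
      rfl hΨ hΨA hT hnea (by simp only [Matrix.of_apply]; rw [hαa, hαr]; exact hα0)
      (by simp only [Matrix.of_apply]; rw [hαa, hαr]; exact hα1)
  simp only [Matrix.of_apply] at hα'' hβ'' hne'' hδ''
  -- … and its y-rows lie in `(resVertex (c (k+1)))^⊥` (XIII)
  have hy'' := PhiLine.yRows_annihilate_of_label 5 (d := 4) (by norm_num) hF₁ hd₁ hA'B' hB'A' (he (k + 1) hk1) hδ''
  refine ⟨A', B', ⟨⟨fun t u => ?_, ?_, fun i hi1 hi2 w hw' => hy'' i hi1 hi2 w hw', hr₁h, hne'', hδ'', ?_⟩, ?_⟩, ?_⟩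
  · have h1 := congrFun (congrFun hB'A' t) u
    rw [Matrix.mul_apply, Matrix.one_apply] at h1
    exact h1
  · rw [hA'u1, hAu1]
  · rw [hα'', hαa, hαr]; exact hα12
  · rw [hα'', hαa, hαr]; exact hα0
  · rw [hβ'', ← hβr]; exact hβa

end ResCone

end Summit.ResolutionOfSingularities.ResolutionOfSingularities.Theorems.PIDim4

end
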